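import Literature.AlgebraicGeometry.Frobenioids.BiratGerms
import Literature.AlgebraicGeometry.Frobenioids.UnitTrivializationIsFrobenioid
import HarnessLib

/-!
# Frobenioids I, Prop. 5.5 (iii) input: `Φ^birat` of `C` is contained in `Φ^birat` of `C^un-tr`

Mochizuki, *The geometry of Frobenioids I: the general theory*, Kyushu J. Math. **62** (2008)
293–400, §4 Prop. 4.4 (iii)/(iv) p. 83 (the rational function monoid `Φ^birat ⊆ Φ^gp`), §5
Prop. 5.5 (iii) p. 104 ll. 37–39 ("if `C` is of … rationally standard type, then so are `C^un-tr`,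
`C^rlf`", proof p. 105 ll. 20–27 "it follows immediately from the definitions") and (iv) p. 104
("`C^un-tr` … the model Frobenioid associated to the data `Φ, Φ^birat, Φ^birat ↪ Φ^gp`": the
rational function monoid of `C^un-tr` is that of `C`), with Def. 1.3 (vii)(a) p. 24 (isotropic hulls)
and Rem. 1.1.1 (divisor bookkeeping). [cite: MochizukiFrdI2008, Prop. 5.5 (iii) p.104]

PROOF-ONLY companion (cell abc-iut, sub-DAG S7 row `FrdI:Prop5.5(iii)/P55-L07` ratStd half, seat
abc-iut-w5-d250) over THE constructions: the concrete rational-function subfunctor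
`PreFrobenioid.biratSubfunctor` (seat abc-iut-L1-t5; the `phiBirat` of THE birationalization
`PreFrobenioid.biratData`, seats abc-iut-L6-t8/L6-t6) and THE unit-trivialisation
`untrFunctor hF : C^un-tr → F_Φ` (seat abc-iut-L1-d5). It supplies the input of the "rational type"
clause of Def. 4.5 (iii) for `C^un-tr` (strict rationality of an object is read in `Φ^birat`):

* `div_comp_of_isIsometry_isLinear`, `invDiv_comp_of_isIsometry` — Rem. 1.1.1 for post-composition
  with an isometric pre-step `k` (such as an isotropic hull): `Div(δ ≫ k) = Div(δ)` and
  `(Base(δ ≫ k))⁻¹^* Div(δ ≫ k) = Φ(Base k)⁻¹((Base δ)⁻¹^* Div δ)`;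
* `exists_germ_hull_transport` — a birational germ `Φ(δ₁)⁻¹Div(δ₁) − Φ(δ₂)⁻¹Div(δ₂)` of a pair of
  base-equivalent pre-steps `δ₁, δ₂ : Y → A` of a Frobenioid is `Φ(Base k)` of a germ of a pair of
  base-equivalent pre-steps `δ₁′, δ₂′ : Y₁ → A₁` between the ISOTROPIC HULLS `Y → Y₁`, `k : A → A₁`
  (Def. 1.3 (vii)(a): `δᵢ ≫ k` factors uniquely through `Y → Y₁`; the germ is unchanged by the
  isometric base-isomorphism `Y → Y₁`, `BiratGerms.germ_comp_eq`, and moved by `Φ(Base k)⁻¹` by the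
  isometric hull `k`);
* `germ_mem_biratGerms_untr` — a germ between isotropic objects of `C` is a germ of `C^un-tr` at the
  class of the target (Prop. 3.3 (iv): `Base`, `Div`, `deg_Fr` of a class are those of a representative;
  every arrow of `C^un-tr` is co-angular);
* `biratGenerators_subset_untr`, **`biratSubgroup_le_untr`** — hence every generator `Φ(f)(d)` of
  `Φ^birat_C(X)` is a generator of `Φ^birat_{C^un-tr}(X)`, and `Φ^birat_C(X) ⊆ Φ^birat_{C^un-tr}(X)`
  for every `X ∈ Ob(D)`.
No statement of the paper is strengthened; nothing here bears on [IUTchIII] Cor. 3.12.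
-/

namespace Literature.AlgebraicGeometry.Frobenioids

open CategoryTheory Opposite

universe w v v' u u'

namespace PreFrobenioid

variable {D : Type u} [Category.{v} D] {Φ : Dᵒᵖ ⥤ CommMonCat.{w}}
  {C : Type u'} [Category.{v'} C] {F : C ⥤ ElemFrobenioid Φ}

open PreFrobenioidData (ofFunctor)

/-! ### Rem. 1.1.1 for post-composition with an isometric pre-step -/

variable (F) in
/-- `Div(δ ≫ k) = Div(δ)` for `k` a linear isometry (Rem. 1.1.1: `Div(k ∘ δ) = Φ(Base δ)(Div k) +
deg_Fr(k) · Div δ` with `Div k = 0`, `deg_Fr k = 1`). [cite: MochizukiFrdI2008, Rem. 1.1.1] -/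
theorem div_comp_of_isIsometry_isLinear {Y A A₁ : C} (δ : Y ⟶ A) (k : A ⟶ A₁)
    (hk₁ : IsIsometry F k) (hk₂ : IsLinear F k) : Div F (δ ≫ k) = Div F δ := by
  rw [div_comp, show Div F k = 1 from hk₁, show degFr F k = 1 from hk₂, map_one, one_mul, PNat.one_coe,
    pow_one]

variable (F) in
/-- `(Base(δ ≫ k))⁻¹^* Div(δ ≫ k) = Φ((Base k)⁻¹)((Base δ)⁻¹^* Div δ)` for a base-isomorphism `δ` and an
isometric pre-step `k` (Rem. 1.1.1). [cite: MochizukiFrdI2008, Rem. 1.1.1] -/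
theorem invDiv_comp_of_isIsometry {Y A A₁ : C} (δ : Y ⟶ A) (k : A ⟶ A₁) (hδ : IsBaseIso F δ)
    (hk₁ : IsIsometry F k) (hk₂ : IsPreStep F k) (h : IsBaseIso F (δ ≫ k)) :
    haveI : IsIso (Base F k) := hk₂.2
    invDiv F (δ ≫ k) h = pull Φ (inv (Base F k)) (invDiv F δ hδ) := by
  haveI : IsIso (Base F k) := hk₂.2
  haveI : IsIso (Base F δ) := hδ
  haveI : IsIso (Base F (δ ≫ k)) := h
  have e : inv (Base F (δ ≫ k)) = inv (Base F k) ≫ inv (Base F δ) := by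
    simp only [base_comp, IsIso.inv_comp]
  unfold invDiv
  rw [div_comp_of_isIsometry_isLinear F δ k hk₁ hk₂.1, ← pull_comp, e]

/-! ### Transport of birational germs to the isotropic hulls (Def. 1.3 (vii)(a)) -/

/-- **Hull transport of a birational germ.** For a pair of base-equivalent pre-steps
`δ₁, δ₂ : Y → A` of a Frobenioid, `δ₁` co-angular, there are isotropic hulls `Y → Y₁`, `k : A → A₁`
and a pair of base-equivalent pre-steps `δ₁′, δ₂′ : Y₁ → A₁` between ISOTROPIC objects, `δ₁′`
co-angular, whose germ is carried to the germ of `(δ₁, δ₂)` by `Φ(Base k)`: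
`Φ(δ₁)⁻¹Div δ₁ − Φ(δ₂)⁻¹Div δ₂ = Φ(Base k)(Φ(δ₁′)⁻¹Div δ₁′ − Φ(δ₂′)⁻¹Div δ₂′)`.
[cite: MochizukiFrdI2008, Def. 1.3 (vii) p.24] -/
theorem exists_germ_hull_transport (hF : IsFrobenioid F) {Y A : C} (δ₁ δ₂ : Y ⟶ A)
    (h₁ : IsCoAngularPreStep F δ₁) (h₂ : IsPreStep F δ₂) (hb : BaseEquivalent F δ₁ δ₂) :
    ∃ (Y₁ A₁ : C) (k : A ⟶ A₁) (δ₁' δ₂' : Y₁ ⟶ A₁) (h₁' : IsCoAngularPreStep F δ₁')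
      (h₂' : IsPreStep F δ₂'), IsPreStep F k ∧ IsIsotropic F Y₁ ∧ IsIsotropic F A₁ ∧
        BaseEquivalent F δ₁' δ₂' ∧
        Algebra.GrothendieckGroup.of (invDiv F δ₁ h₁.2.2) / Algebra.GrothendieckGroup.of (invDiv F δ₂ h₂.2) =
          pullGp Φ (Base F k) (Algebra.GrothendieckGroup.of (invDiv F δ₁' h₁'.2.2) /
            Algebra.GrothendieckGroup.of (invDiv F δ₂' h₂'.2)) := by
  obtain ⟨A₁, k, hk⟩ := hF.vii_a A
  obtain ⟨Y₁, kY, hkY⟩ := hF.vii_a Y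
  obtain ⟨δ₁', hδ₁', -⟩ := hkY.2.2.2 (δ₁ ≫ k) hk.2.2.1
  obtain ⟨δ₂', hδ₂', -⟩ := hkY.2.2.2 (δ₂ ≫ k) hk.2.2.1
  haveI hkiso : IsIso (Base F k) := hk.2.1.2
  haveI hkYiso : IsIso (Base F kY) := hkY.2.1.2
  -- base relations `Base kY ≫ Base δᵢ' = Base δᵢ ≫ Base k`
  have hB₁ : Base F kY ≫ Base F δ₁' = Base F δ₁ ≫ Base F k := by
    rw [← base_comp, hδ₁', base_comp]
  have hB₂ : Base F kY ≫ Base F δ₂' = Base F δ₂ ≫ Base F k := by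
    rw [← base_comp, hδ₂', base_comp]
  -- the `δᵢ'` are pre-steps
  have hlin : ∀ {δ : Y ⟶ A} {δ' : Y₁ ⟶ A₁}, IsLinear F δ → kY ≫ δ' = δ ≫ k → IsLinear F δ' := by
    intro δ δ' hδ e
    have h := degFr_comp F kY δ'
    rw [e, degFr_comp, show degFr F kY = 1 from hkY.2.1.1, show degFr F k = 1 from hk.2.1.1,
      show degFr F δ = 1 from hδ, one_mul, one_mul] at h
    exact h.symm
  have hbi : ∀ {δ : Y ⟶ A} {δ' : Y₁ ⟶ A₁}, IsBaseIso F δ →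
      Base F kY ≫ Base F δ' = Base F δ ≫ Base F k → IsBaseIso F δ' := by
    intro δ δ' hδ e
    haveI : IsIso (Base F δ) := hδ
    have e' : Base F δ' = inv (Base F kY) ≫ (Base F δ ≫ Base F k) := by
      rw [IsIso.eq_inv_comp, e]
    change IsIso (Base F δ')
    rw [e']
    infer_instance
  have hp₁ : IsPreStep F δ₁' := ⟨hlin h₁.2.1 hδ₁', hbi h₁.2.2 hB₁⟩
  have hp₂ : IsPreStep F δ₂' := ⟨hlin h₂.1 hδ₂', hbi h₂.2 hB₂⟩
  have hc₁ : IsCoAngularPreStep F δ₁' := ⟨isCoAngular_of_isIsotropic_src hF δ₁' hkY.2.2.1, hp₁⟩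
  have hb' : BaseEquivalent F δ₁' δ₂' := by
    change Base F δ₁' = Base F δ₂'
    apply (cancel_epi (Base F kY)).mp
    rw [hB₁, hB₂, show Base F δ₁ = Base F δ₂ from hb]
  refine ⟨Y₁, A₁, k, δ₁', δ₂', hc₁, hp₂, hk.2.1, hkY.2.2.1, hk.2.2.1, hb', ?_⟩
  -- germ bookkeeping
  have hkYbi : IsBaseIso F kY := hkY.2.1.2
  have e₁ : IsBaseIso F (kY ≫ δ₁') := IsBaseIso.comp F hkYbi hp₁.2
  have e₂ : IsBaseIso F (kY ≫ δ₂') := IsBaseIso.comp F hkYbi hp₂.2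
  have g := germ_comp_eq F kY δ₁' δ₂' hkYbi hp₁ hp₂ hb' e₁ e₂
  have f₁ : IsBaseIso F (δ₁ ≫ k) := IsBaseIso.comp F h₁.2.2 hk.2.1.2
  have f₂ : IsBaseIso F (δ₂ ≫ k) := IsBaseIso.comp F h₂.2 hk.2.1.2
  rw [RatFrac.invDiv_congr F hδ₁' e₁ f₁, RatFrac.invDiv_congr F hδ₂' e₂ f₂,
    invDiv_comp_of_isIsometry F δ₁ k h₁.2.2 hk.1 hk.2.1 f₁,
    invDiv_comp_of_isIsometry F δ₂ k h₂.2 hk.1 hk.2.1 f₂, ← pullGp_of', ← pullGp_of', ← map_div] at g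
  rw [← g, pullGp_pullGp_inv]

/-! ### Germs between isotropic objects are germs of `C^un-tr` -/

/-- A birational germ of `C` of a pair of base-equivalent pre-steps `δ₁′, δ₂′ : Y₁ → A₁` between
ISOTROPIC objects is a birational germ of `C^un-tr` at the class of `A₁`: the classes `[δᵢ′]` are
pre-steps of `C^un-tr` (co-angular, as is every arrow of `C^un-tr`) with the same `Base`, `Div`
(Prop. 3.3 (iv)). [cite: MochizukiFrdI2008, Prop. 3.3 (iv) p.60] -/
theorem germ_mem_biratGerms_untr (hF : IsFrobenioid F) {Y₁ A₁ : C} (hY : IsIsotropic F Y₁)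
    (hA : IsIsotropic F A₁) (δ₁' δ₂' : Y₁ ⟶ A₁) (h₁' : IsCoAngularPreStep F δ₁') (h₂' : IsPreStep F δ₂')
    (hb' : BaseEquivalent F δ₁' δ₂') :
    Algebra.GrothendieckGroup.of (invDiv F δ₁' h₁'.2.2) / Algebra.GrothendieckGroup.of (invDiv F δ₂' h₂'.2) ∈
      biratGerms (untrFunctor hF)
        ((ofFunctor Φ F).toUntr.obj ⟨A₁, isIsotropic_data_of hA⟩) := by
  let Yi : (ofFunctor Φ F).Istr := ⟨Y₁, isIsotropic_data_of hY⟩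
  let Ai : (ofFunctor Φ F).Istr := ⟨A₁, isIsotropic_data_of hA⟩
  let d₁ : Yi ⟶ Ai := ObjectProperty.homMk δ₁'
  let d₂ : Yi ⟶ Ai := ObjectProperty.homMk δ₂'
  have hd₁ : IsCoAngularPreStep (untrFunctor hF) ((ofFunctor Φ F).toUntr.map d₁) :=
    isCoAngularPreStep_toUntr_of hF d₁ h₁'.2
  have hd₂ : IsPreStep (untrFunctor hF) ((ofFunctor Φ F).toUntr.map d₂) :=
    (isPreStep_toUntr_iff d₂).mpr h₂'
  have hbd : BaseEquivalent (untrFunctor hF) ((ofFunctor Φ F).toUntr.map d₁)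
      ((ofFunctor Φ F).toUntr.map d₂) := hb'
  refine ⟨(ofFunctor Φ F).toUntr.obj Yi, (ofFunctor Φ F).toUntr.map d₁, (ofFunctor Φ F).toUntr.map d₂,
    hd₁, hd₂, hbd, ?_⟩
  rfl

/-! ### `Φ^birat_C ⊆ Φ^birat_{C^un-tr}` -/

/-- Every generator `Φ(f)(d)` (`f : X → Base A`, `d` a germ of `C` at `A`) of `Φ^birat_C(X)` is a
generator of `Φ^birat_{C^un-tr}(X)`: transport `d` to the isotropic hull `k : A → A₁`
(`exists_germ_hull_transport`), read the transported germ in `C^un-tr` (`germ_mem_biratGerms_untr`),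
and pull back along `f ≫ Base k`. [cite: MochizukiFrdI2008, Prop. 5.5 (iv) p.104] -/
theorem biratGenerators_subset_untr (hF : IsFrobenioid F) (X : D) :
    biratGenerators F X ⊆ biratGenerators (untrFunctor hF) X := by
  rintro c ⟨A, f, d, ⟨Y, δ₁, δ₂, h₁, h₂, hb, rfl⟩, rfl⟩
  obtain ⟨Y₁, A₁, k, δ₁', δ₂', h₁', h₂', hk, hY, hA, hb', hg⟩ :=
    exists_germ_hull_transport hF δ₁ δ₂ h₁ h₂ hb
  refine ⟨(ofFunctor Φ F).toUntr.obj ⟨A₁, isIsotropic_data_of hA⟩, f ≫ Base F k, _,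
    germ_mem_biratGerms_untr hF hY hA δ₁' δ₂' h₁' h₂' hb', ?_⟩
  rw [pullGp_comp]
  exact congrArg (pullGp Φ f) hg

/-- **`Φ^birat_C(X) ⊆ Φ^birat_{C^un-tr}(X)`** for every `X ∈ Ob(D)`: the rational function monoid of a
Frobenioid `C → F_Φ` (the concrete subfunctor generated by the birational germs, = `phiBirat` of THE
birationalization `biratData hF _`) is contained in that of its unit-trivialisation
`C^un-tr → F_Φ` (print, Prop. 5.5 (iv): `C^un-tr` is the model Frobenioid of `(Φ, Φ^birat)` — the same
`Φ^birat`; here the inclusion needed for Prop. 5.5 (iii)'s "rationally standard" clause).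
[cite: MochizukiFrdI2008, Prop. 5.5 (iv) p.104] -/
theorem biratSubgroup_le_untr (hF : IsFrobenioid F) (X : D) :
    biratSubgroup F X ≤ biratSubgroup (untrFunctor hF) X := by
  change Subgroup.closure (biratGenerators F X) ≤ Subgroup.closure (biratGenerators (untrFunctor hF) X)
  exact Subgroup.closure_mono (biratGenerators_subset_untr hF X)

end PreFrobenioid

end Literature.AlgebraicGeometry.Frobenioids
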